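import Summits.QuantumFields.BalabanUV.Beta.FP.TowerDoorPeriodisedRegroup
import Summits.QuantumFields.BalabanUV.Beta.FP.TowerDoorDefectTorus
import Summits.QuantumFields.BalabanUV.Beta.FP.TowerDoorRecordDefs
import Summits.QuantumFields.BalabanUV.Beta.FP.TowerDoorGaugeBound
import Summits.QuantumFields.BalabanUV.Beta.FP.TowerDoorGaugeLatticeSum

/-!
# `BalabanUV.Beta.FP.TowerDoorRecordPeriodised` — binder row D1, the row's ONE file, (T2) AT THE RECORD (J-NOTE-21 §5 (D); v10 `FP/StepRecursionFeedNestedNamedI` l.217):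
# **v10's LETTER `hWΔT` FOR THE RECORD DOOR `𝒲Δ := doorRec Lc Pn sn cS κ₂ κτ` — THE SOURCE-WOUND TORUS TABLE OF THE DOOR IS `−(sn·cM₂·r) •` THE SYMMETRISED `Ŝ`-CONTRACTION OF THE
# WARD-DEFECT BRACKET AT `λ = lv ((sn·r)•e_(wrapPt y, μ))`** — stated LITERALLY as v10 binds it (its `∀ n μ y ν y′ B` body verbatim with `𝒲Δ (n+1) ↦ doorRec … (n+1)`), under THREE displayed letters:
# `hM₂` (v10's own, verbatim), `hlv` (PART 57 `lv_smul_single_eq_tsum_lamZ_at_pins`'s CONCLUSION SHAPE: `lv ((sn r)•e_(wrapPt y, μ)) s = (sn r)·Σ'_m λℤ_(μ, translate (Mc B) ↑(wrapPt y) m)(↑s)`,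
# discharged at the END by PART 57 over (D) §2's binders) and the SCALAR PIN `hpin : κτ n · cS n = −(sn n·cM₂ n·r n)·(sn n·r n)` (v10 leaves `cS κτ` free; this is the one relation (T2) asks)
# (β-function cell `pub-balaban`, BINDER-OWNERS row D1 ∕ (C1) OWNER «beta-an2» gen 78, PART 74; imports PART 73 + road (S2) `TowerDoorDefectTorus` + PART 69 + PART 59 + PART 58)

WHY (located; J-NOTE-21 §5, journal [AN2-G78-ONLINE] A-1, road INTENT-5 l.68810).  Entrywise on the `ff` block, the left side is `perZ T (dper T (x w ↦ Σ'_e doorZ …))` of PART 62's door over the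
record letters (`doorRec_succ`), which PART 73 `perZ_dper_tsum_sources_doorZ` evaluates as `κτ·Σ_κ Σ_{ȳ₀} (Ŝ′_(ν,y′)·P(Λ_(μ,y)) + Ŝ′_(μ,y)·P(Λ_(ν,y′)))` at `lam := lamRec`, `S := SRec` (letters: PART 59
`exists_abs_lamZ_record_le_exp`, PART 58 `lamZ_translate`, lit `decay_wΦ`, `SRec`'s covariance `rfl`-class, `towerTorus_apply`); the weight `Ŝ′ = cS·Σ'_m wΦ κ ν (ȳ₀ − translate Mc y′ m)` is
`cS·`v10's `perF T (AN ρc (n+1)) (wrapPt T (L•ȳ₀), inr κ) (wrapPt T (L•↑(wrapPt y′)), inr ν)` by PART 47 `perF_AN_inr_inr_wrapPt_eq_tsum_wΦ`; each `P(Λ)` entry is road (S2)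
`perZ_dper_defKerZ_inl_inl` (the bracket in `M2Z` letters, `Λ` bounded by PART 71 `abs_tsum_lam_sources_le` and `T`-periodic by PART 72 `tsum_lam_sources_translate_period`); on the right side
`hM₂` displays `(M₂ n B) b β`, `hlv` displays the gauge function as `(sn r)·Λ_(μ,y)` (the `wrapPt` representative re-indexed away: `translate_wrap_eq`), road (S1) `sum_tgrad_inl_mul_of_periodic`
turns `Σ_s tgrad · λ` into the lattice gradient, and the two sides agree entry by entry up to the scalar pin.

WHAT ([folklore] `tsum`∕`perZ∘dper`∕`Matrix` bookkeeping BY NAME; no `def`, no `def … : Prop`, nothing cited, 0 sorry).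
* §1 the record letters: `towerTorus_fine_apply'` (`T i = Lc^(n+2)·Mc B i`), `doorRec_succ_comp` (`rfl`, v10's `tabsComp` spelling), `exists_lamRec_loc` (PART 59), `lamRec_translate` (PART 58),
  `exists_SRec_decay` (lit `decay_wΦ`), `SRec_translate`, `tsum_SRec_sources` (PART 47), `tsum_lamRec_sources_wrapPt` (`translate_wrap_eq`), `sum_scale_bracket` (a scalar through the bracket).
* §2 **`hWΔT_rec`** — v10's (T2) letter at the record under `hM₂ hlv hpin`.
WHAT THIS IS NOT: `hlv` is NOT discharged here (it is PART 57's conclusion at (D) §2's pins — the END passes PART 57 by name); `hpin` is a relation among v10's displayed scalars, NOT valued; nothing of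
Bałaban's asserted, valued or discharged; 0 estimates; the END NOT instantiated; v10 NOT filed (policy); v9 p617999 stands; 0∕4 row-D1 binders (hW, hR, D1Tel, D1Rep); ROOT M‴ p325680 ∕ P5c ∕ D6
untouched; NOT (C1), NOT (T-ID), NOT D1, NEVER «G-an2-4 closed», NOT BetaPertH, NOT continuum, NOT Clay.

HONEST DEPENDENCY (page 1, mandatory): continuum YM on T⁴ ⇐ BetaPertH ∧ nine spine estimates (0/9 proved); BetaPertH ⇐ (D1) ∧ (D4) ∧ CAP+tail;
G-an2-4 gates asym, D1 and NE2/3/4.  HONEST FRAMING (cell contract, verbatim): «discharging `BetaPertH` makes Bałaban's UV stability UNCONDITIONAL —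
a real constructive-QFT result; it is NOT the continuum limit and NOT the Clay problem.»  ABSOLUTE RULE (cell charter, verbatim): «No internally-minted
statement may enter as a cited fact. Every hypothesis is either kernel-proved in this package or a verbatim quotation of a PUBLISHED theorem with page
reference. The manuscript(s) under audit are NOT citable for their own disputed steps — they are the thing under adjudication; programme-internal
(2001/route/tribunal) claims are never citable.»  Row D1 ∕ (C1) OWNER «beta-an2» gen 78, 2026-08-29.  No existing file touched.
-/

noncomputable section

open scoped BigOperators Matrix
open Finset Matrix
open Literature.MathematicalPhysics.QuantumFieldTheory
open Literature.MathematicalPhysics.QuantumFieldTheory.Balaban1983to89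
open Literature.MathematicalPhysics.QuantumFieldTheory.Balaban1983to89.Beta
open Literature.MathematicalPhysics.QuantumFieldTheory.Balaban1983to89.B12Sec2to5 (l1 l1_nonneg)
open B4TorusKernel.MultiPeriod (translate translate_apply)
open B4Reflection242 (translate_translate)
open B4Sect5Proof (latticeConst latticeConst_nonneg)
open B5Prop11Plancherel (fine)
open B6Lemma24Torus (pbox)
open AffineAveraging (Site box toSite unitVec)
open AveragingContoursRooted (ctrOff ctrOff_mem_box)
open OneStepResolventKernel (Fib)
open ExpKernelCalculus (MKer BiLoc VertexFamily)
open HessKerRate (scaleK)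
open KernelSpecInstance (wΦ decay_wΦ)
open SecondOrderResponse (LocStencilFM)
open BalabanStepW2 (M2Of)
open Summit.QuantumFields.BalabanUV.Beta.SymmetrisedStepJets (SymTables)
open Summit.QuantumFields.BalabanUV.Beta.BorderedHessian (sgnK)
open Summit.QuantumFields.BalabanUV.Beta.TameKernelCalculus (trK)
open Summit.QuantumFields.BalabanUV.Beta.AxialDressingRooted (one_le_of_neZero)
open Summit.QuantumFields.BalabanUV.Beta.CompositeOneShotJets (tabsComp)
open Summit.QuantumFields.BalabanUV.Beta.CompositeOneShotJetData (Roots Roots.ctr Pins AN)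
open Summit.QuantumFields.BalabanUV.Beta.GAN24.FineReadoutCauchyFrame (toSite_mem_range)
open Summit.QuantumFields.BalabanUV.Beta.NVertexColumnK1RowTorus (translate_wrap_eq)
open Summit.QuantumFields.BalabanUV.Beta.GAN24.KernelPeriodisation (quo)
open Summit.QuantumFields.BalabanUV.Beta.FP.KernelPeriodisationFib (Idx perF perZ perF_apply)
open Summit.QuantumFields.BalabanUV.Beta.FP.KernelPeriodisationFibLoc (dper)
open Summit.QuantumFields.BalabanUV.Beta.FP.TorusGaugeCovariance (tgrad)
open Summit.QuantumFields.BalabanUV.Beta.FP.TorusGaugeCovariancePairing (wrapPt wrapPt_coe)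
open Summit.QuantumFields.BalabanUV.Beta.FP.TorusCompositeObjects (towerTorus towerTorus_apply bigRatio bigRatio_eq_pow)
open Summit.QuantumFields.BalabanUV.Beta.FP.TowerK2bDoorReadoutPeriodised (perF_AN_inr_inr_wrapPt_eq_tsum_wΦ)
open Summit.QuantumFields.BalabanUV.Beta.FP.TowerDoorDefectDefs
open Summit.QuantumFields.BalabanUV.Beta.FP.TowerDoorGaugeRefDefs (lamZ)
open Summit.QuantumFields.BalabanUV.Beta.FP.TowerDoorGaugeLatticeSum (lamZ_translate)
open Summit.QuantumFields.BalabanUV.Beta.FP.TowerDoorGaugeBound (exists_abs_lamZ_record_le_exp)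
open Summit.QuantumFields.BalabanUV.Beta.FP.TowerDoorRecordDefs
open Summit.QuantumFields.BalabanUV.Beta.FP.TowerDoorPeriodisedSource (abs_tsum_lam_sources_le)
open Summit.QuantumFields.BalabanUV.Beta.FP.TowerDoorPeriodisedWindow (tsum_lam_sources_translate_period)
open Summit.QuantumFields.BalabanUV.Beta.FP.TowerDoorPeriodisedRegroup (perZ_dper_tsum_sources_doorZ)
open Summit.QuantumFields.BalabanUV.Beta.FP.TowerDoorDefectTorusPieces (sum_tgrad_inl_mul_of_periodic)
open Summit.QuantumFields.BalabanUV.Beta.FP.TowerDoorDefectTorus (perZ_dper_defKerZ_inl_inl)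

namespace Summit.QuantumFields.BalabanUV.Beta.FP.TowerDoorRecordPeriodised

variable (Lc : ℕ) [NeZero Lc] (Pn : Pins) (sn cS κ₂ κτ : ℕ → ℝ)

/-! ## §1 The record letters -/

omit [NeZero Lc] in
/-- [folklore] the finest torus of the `(n+1)`-tower over the coarse box: `towerTorus Lc (fine Lc M) (n+1) i = Lc^(n+2) · M i` (`towerTorus_apply`, `fine` by `rfl`). -/
theorem towerTorus_fine_apply' (M : Fin (3 + 1) → ℕ) (n : ℕ) (i : Fin (3 + 1)) : towerTorus Lc (fine Lc M) (n + 1) i = Lc ^ (n + 1 + 1) * M i := by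
  rw [towerTorus_apply]
  show Lc ^ (n + 1) * (Lc * M i) = Lc ^ (n + 1 + 1) * M i
  ring

/-- [folklore] the record door at index `n+1`, in v10's `tabsComp` spelling of the table record (`rfl`). -/
theorem doorRec_succ_comp (n : ℕ) : doorRec Lc Pn sn cS κ₂ κτ (n + 1)
    = doorZ (Lc ^ (n + 1 + 1)) (tabsComp (n + 1 + 1) (one_le_of_neZero Lc) (Roots.ctr Lc).hr (Pn.cM (n + 1 + 1))) (κ₂ n) (κτ n) (lamRec Lc (sn n) n) (SRec Lc (cS n) n) := rfl

/-- [folklore] **the record gauge functions are exponentially localised at the source block** (PART 59 `exists_abs_lamZ_record_le_exp`, `bigRatio_eq_pow`). -/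
theorem exists_lamRec_loc (n : ℕ) : ∃ δv K : ℝ, 0 < δv ∧ 0 ≤ K ∧ ∀ (μ : Fin (3 + 1)) (y u : Site (3 + 1)),
    |lamRec Lc (sn n) n μ y u| ≤ K * Real.exp (-δv * l1 ((((Lc ^ (n + 1 + 1) : ℕ) : ℤ) • y) - u)) := by
  obtain ⟨δv, hδv, K, hK, h⟩ := exists_abs_lamZ_record_le_exp (Roots.ctr Lc) (fun i : ℕ => n + 1 - i) (fun _ : ℕ => ctrOff (3 + 1) Lc)
    (fun _ => toSite_mem_range (ctrOff_mem_box (d := 3 + 1) (Nat.one_le_iff_ne_zero.mpr (NeZero.ne Lc)))) n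
    (Sum.elim (fun _ : Fin (3 + 1) => (1 : ℝ)) (fun _ : Fin (3 + 1) => (sn n)⁻¹))
  simp only [bigRatio_eq_pow] at h
  exact ⟨δv, K, hδv, hK, h⟩

/-- [folklore] **the record gauge functions are jointly block covariant** (PART 58 `lamZ_translate`, `bigRatio_eq_pow`). -/
theorem lamRec_translate (n : ℕ) (μ : Fin (3 + 1)) (y u t : Site (3 + 1)) :
    lamRec Lc (sn n) n μ (y + t) (u + (((Lc ^ (n + 1 + 1) : ℕ) : ℤ) • t)) = lamRec Lc (sn n) n μ y u := by
  have h := lamZ_translate Lc (fun i : ℕ => n + 1 - i) (fun _ : ℕ => ctrOff (3 + 1) Lc)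
    (fun _ => toSite_mem_range (ctrOff_mem_box (d := 3 + 1) (Nat.one_le_iff_ne_zero.mpr (NeZero.ne Lc)))) n
    (scaleK (Sum.elim (fun _ : Fin (3 + 1) => (1 : ℝ)) (fun _ : Fin (3 + 1) => (sn n)⁻¹)) (Sum.elim (fun _ : Fin (3 + 1) => (1 : ℝ)) (fun _ : Fin (3 + 1) => (sn n)⁻¹))
      (AN (Roots.ctr Lc) (n + 1))) μ y u t
  simp only [bigRatio_eq_pow] at h
  exact h

/-- [folklore] **the record read-out weight decays exponentially** (lit `decay_wΦ` at `N := Lc^(n+2)`). -/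
theorem exists_SRec_decay (n : ℕ) : ∃ δS CS : ℝ, 0 < δS ∧ 0 ≤ CS ∧ ∀ (ν : Fin (3 + 1)) (z : Site (3 + 1)) (κ : Fin (3 + 1)) (y₀ : Site (3 + 1)),
    |SRec Lc (cS n) n ν z κ y₀| ≤ CS * Real.exp (-δS * l1 (y₀ - z)) := by
  obtain ⟨δS, CΦ, hδS, hΦ⟩ := decay_wΦ (N := Lc ^ (n + 1 + 1)) (d := 3)
  have hCΦ : 0 ≤ CΦ := by
    have h := hΦ 0 0 0
    have e0 : l1 (0 : Site (3 + 1)) = 0 := by simp [l1]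
    rw [e0, mul_zero, Real.exp_zero, mul_one] at h
    exact (abs_nonneg _).trans h
  refine ⟨δS, |cS n| * CΦ, hδS, by positivity, fun ν z κ y₀ => ?_⟩
  unfold SRec
  rw [abs_mul, mul_assoc]
  exact mul_le_mul_of_nonneg_left (hΦ κ ν (y₀ - z)) (abs_nonneg _)

/-- [folklore] the record read-out weight is jointly covariant (`wΦ κ ν (y₀ − z)`). -/
theorem SRec_translate (n : ℕ) (ν : Fin (3 + 1)) (z : Site (3 + 1)) (κ : Fin (3 + 1)) (y₀ t : Site (3 + 1)) :
    SRec Lc (cS n) n ν (z + t) κ (y₀ + t) = SRec Lc (cS n) n ν z κ y₀ := by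
  unfold SRec
  rw [add_sub_add_right_eq_sub]

/-- [folklore] **the wound record weight is `cS ·` v10's torus read-out weight** (PART 47 `perF_AN_inr_inr_wrapPt_eq_tsum_wΦ`, `tsum_mul_left`). -/
theorem tsum_SRec_sources (n : ℕ) (T M' : Fin (3 + 1) → ℕ) [∀ i, NeZero (T i)] [∀ i, NeZero (M' i)] (hT : ∀ i, T i = Lc ^ (n + 1 + 1) * M' i)
    (ν : Fin (3 + 1)) (y' : Site (3 + 1)) (κ : Fin (3 + 1)) (r : Site (3 + 1)) :
    ∑' e : Site (3 + 1), SRec Lc (cS n) n ν (translate M' y' e) κ r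
      = cS n * perF T (AN (Roots.ctr Lc) (n + 1)) (wrapPt T (((Lc ^ (n + 1 + 1) : ℕ) : ℤ) • r), Sum.inr κ)
          (wrapPt T (((Lc ^ (n + 1 + 1) : ℕ) : ℤ) • ((wrapPt M' y' : ↥(pbox M')) : Site (3 + 1))), Sum.inr ν) := by
  unfold SRec
  rw [tsum_mul_left, perF_AN_inr_inr_wrapPt_eq_tsum_wΦ (Roots.ctr Lc) (n + 1) T M' hT κ ν r y']

/-- [folklore] **the source copies do not see the representative**: `Σ'_m λ_(μ, translate M′ ↑(wrapPt M′ y) m) u = Σ'_m λ_(μ, translate M′ y m) u` (`translate_wrap_eq`, re-indexing `m ↦ m − quo y`). -/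
theorem tsum_lamRec_sources_wrapPt (n : ℕ) (M' : Fin (3 + 1) → ℕ) [∀ i, NeZero (M' i)] (μ : Fin (3 + 1)) (y u : Site (3 + 1)) :
    ∑' m : Site (3 + 1), lamRec Lc (sn n) n μ (translate M' ((wrapPt M' y : ↥(pbox M')) : Site (3 + 1)) m) u
      = ∑' m : Site (3 + 1), lamRec Lc (sn n) n μ (translate M' y m) u := by
  rw [wrapPt_coe]
  simp_rw [translate_wrap_eq M' y]
  exact (Equiv.subRight (quo M' y)).tsum_eq (fun m : Site (3 + 1) => lamRec Lc (sn n) n μ (translate M' y m) u)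

omit [NeZero Lc] in
/-- [folklore] a scalar through v10's defect bracket, entrywise: `Σ_b (c·f b − c·g b)·P b − κ·((c·a)·C − C·(c·a′)) = c·(Σ_b (f b − g b)·P b − κ·(a·C − C·a′))`. -/
theorem sum_scale_bracket {ι : Type*} [Fintype ι] (c κ a a' C : ℝ) (f g P : ι → ℝ) :
    (∑ b : ι, (c * f b - c * g b) * P b) - κ * (c * a * C - C * (c * a')) = c * ((∑ b : ι, (f b - g b) * P b) - κ * (a * C - C * a')) := by
  have h : ∑ b : ι, (c * f b - c * g b) * P b = c * ∑ b : ι, (f b - g b) * P b := by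
    rw [Finset.mul_sum]
    exact Finset.sum_congr rfl fun b _ => by ring
  rw [h]
  ring

omit [NeZero Lc] in
/-- [folklore] the scalar pin closes one `(κ, ȳ₀)` term: `κτ·((cS·W₁)·E₁ + (cS·W₂)·E₂) = A·(W₁·(c·E₁) + W₂·(c·E₂))` whenever `κτ·cS = A·c`. -/
theorem pin_close {κτ' cS' A c W₁ W₂ E₁ E₂ : ℝ} (h : κτ' * cS' = A * c) :
    κτ' * ((cS' * W₁) * E₁ + (cS' * W₂) * E₂) = A * (W₁ * (c * E₁) + W₂ * (c * E₂)) := by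
  linear_combination (W₁ * E₁ + W₂ * E₂) * h

/-! ## §2 v10's (T2) letter at the record -/

/-- [folklore] **`hWΔT_rec` — v10 `FP/StepRecursionFeedNestedNamedI`'s LETTER `hWΔT` FOR THE RECORD DOOR `𝒲Δ := doorRec Lc Pn sn cS κ₂ κτ`**, under v10's own `hM₂`, the conclusion shape `hlv` of
PART 57 (`lv ((sn r)•e_(wrapPt y, μ)) s = (sn r)·Σ'_m λℤ_(μ, translate (Mc B) ↑(wrapPt y) m)(↑s)`) and the scalar pin `hpin : κτ n·cS n = −(sn n·cM₂ n·r n)·(sn n·r n)`. -/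
theorem hWΔT_rec (cM₂ : ∀ n : ℕ, ℝ) (r : ∀ n : ℕ, ℝ)
    (Mc : ℕ → (Fin (3 + 1) → ℕ)) [∀ B μ, NeZero (Mc B μ)]
    (lv : ∀ n : ℕ, ∀ B : ℕ, ((↥(pbox (Mc B)) × Fin (3 + 1)) → ℝ) → (↥(pbox (towerTorus Lc (fine Lc (Mc B)) (n + 1))) → ℝ))
    (M₂ : ∀ n : ℕ, ∀ B : ℕ, (↥(pbox (towerTorus Lc (fine Lc (Mc B)) (n + 1))) × Fin (3 + 1)) → (↥(pbox (Mc B)) × Fin (3 + 1)) → Matrix (↥(pbox (towerTorus Lc (fine Lc (Mc B)) (n + 1))) × Fin (3 + 1)) (↥(pbox (towerTorus Lc (fine Lc (Mc B)) (n + 1))) × Fin (3 + 1)) ℝ)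
    (hM₂ : ∀ n : ℕ, ∀ B : ℕ, ∀ (b : ↥(pbox (towerTorus Lc (fine Lc (Mc B)) (n + 1))) × Fin (3 + 1)) (β : ↥(pbox (Mc B)) × Fin (3 + 1)), ((M₂ n) B) b β = (perF (towerTorus Lc (fine Lc (Mc B)) (n + 1)) (dper (towerTorus Lc (fine Lc (Mc B)) (n + 1)) (fun X Z i₁ i₂ => ∑' m : Site (3 + 1), ((1 / 2 : ℝ) • (M2Of 3 (Lc ^ (n + 1 + 1)) (tabsComp (n + 1 + 1) (one_le_of_neZero Lc) (Roots.ctr Lc).hr (Pn.cM (n + 1 + 1))).mixFF 0 b.2 (b.1 : Site (3 + 1)) β.2 (translate (Mc B) (β.1 : Site (3 + 1)) m) + sgnK (trK (M2Of 3 (Lc ^ (n + 1 + 1)) (tabsComp (n + 1 + 1) (one_le_of_neZero Lc) (Roots.ctr Lc).hr (Pn.cM (n + 1 + 1))).mixFF 0 b.2 (b.1 : Site (3 + 1)) β.2 (translate (Mc B) (β.1 : Site (3 + 1)) m))))) X Z i₁ i₂))).submatrix (fun b : ↥(pbox (towerTorus Lc (fine Lc (Mc B)) (n + 1))) × Fin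 (3 + 1) => ((b.1, Sum.inl b.2) : Idx (towerTorus Lc (fine Lc (Mc B)) (n + 1)) (Fib 3))) (fun b : ↥(pbox (towerTorus Lc (fine Lc (Mc B)) (n + 1))) × Fin (3 + 1) => ((b.1, Sum.inl b.2) : Idx (towerTorus Lc (fine Lc (Mc B)) (n + 1)) (Fib 3))))
    (hlv : ∀ n : ℕ, ∀ B : ℕ, ∀ (μ : Fin (3 + 1)) (y : Site (3 + 1)) (s : ↥(pbox (towerTorus Lc (fine Lc (Mc B)) (n + 1)))),
      ((lv n) B) (((sn n) * (r n)) • (Pi.single (wrapPt (Mc B) y, μ) (1 : ℝ) : ((↥(pbox (Mc B)) × Fin (3 + 1)) → ℝ))) s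
        = ((sn n) * (r n)) * ∑' m : Site (3 + 1), lamRec Lc (sn n) n μ (translate (Mc B) ((wrapPt (Mc B) y : ↥(pbox (Mc B))) : Site (3 + 1)) m) (s : Site (3 + 1)))
    (hpin : ∀ n : ℕ, κτ n * cS n = -((sn n) * (cM₂ n) * (r n)) * ((sn n) * (r n))) :
    ∀ n : ℕ, ∀ (μ : Fin (3 + 1)) (y : Site (3 + 1)) (ν : Fin (3 + 1)) (y' : Site (3 + 1)), ∀ B : ℕ, (perF (towerTorus Lc (fine Lc (Mc B)) (n + 1)) (dper (towerTorus Lc (fine Lc (Mc B)) (n + 1)) (fun x w a b => ∑' e : Site (3 + 1), doorRec Lc Pn sn cS κ₂ κτ (n + 1) μ y ν (translate (Mc B) y' e) x w a b))).submatrix (fun b : ↥(pbox (towerTorus Lc (fine Lc (Mc B)) (n + 1))) × Fin (3 + 1) => ((b.1, Sum.inl b.2) : Idx (towerTorus Lc (fine Lc (Mc B)) (n + 1)) (Fib 3))) (fun b : ↥(pbox (towerTorus Lc (fine Lc (Mc B)) (n + 1))) × Fin (3 + 1) => ((b.1, Sum.inl b.2) : Idx (towerTorus Lc (fine Lc (Mc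 B)) (n + 1)) (Fib 3))) = -((sn n) * (cM₂ n) * (r n)) • ∑ β : ↥(pbox (Mc B)) × Fin (3 + 1), (perF (towerTorus Lc (fine Lc (Mc B)) (n + 1)) (AN (Roots.ctr Lc) (n + 1)) (wrapPt (towerTorus Lc (fine Lc (Mc B)) (n + 1)) (((Lc ^ (n + 1 + 1) : ℕ) : ℤ) • (β.1 : Site (3 + 1))), Sum.inr β.2) (wrapPt (towerTorus Lc (fine Lc (Mc B)) (n + 1)) (((Lc ^ (n + 1 + 1) : ℕ) : ℤ) • ((wrapPt (Mc B) y' : ↥(pbox (Mc B))) : Site (3 + 1))), Sum.inr ν) • (∑ b : ↥(pbox (towerTorus Lc (fine Lc (Mc B)) (n + 1))) × Fin (3 + 1), (∑ s : ↥(pbox (towerTorus Lc (fine Lc (Mc B)) (n + 1))), tgrad (towerTorus Lc (fine Lc (Mc B)) (n + 1)) (b.1, Sum.inl b.2) s * ((lv n) B) (((sn n) * (r n)) • (Pi.single (wrapPt (Mc B) y, μ) (1 : ℝ) : ((↥(pbox (Mc B)) × Fin (3 + 1)) → ℝ))) s) • ((M₂ n) B) b β - (κ₂ n) • (Matrix.diagonal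 (fun b : ↥(pbox (towerTorus Lc (fine Lc (Mc B)) (n + 1))) × Fin (3 + 1) => ((lv n) B) (((sn n) * (r n)) • (Pi.single (wrapPt (Mc B) y, μ) (1 : ℝ) : ((↥(pbox (Mc B)) × Fin (3 + 1)) → ℝ))) b.1) * (perF (towerTorus Lc (fine Lc (Mc B)) (n + 1)) (dper (towerTorus Lc (fine Lc (Mc B)) (n + 1)) ((tabsComp (n + 1 + 1) (one_le_of_neZero Lc) (Roots.ctr Lc).hr (Pn.cM (n + 1 + 1))).H β.2 (β.1 : Site (3 + 1))))).submatrix (fun b : ↥(pbox (towerTorus Lc (fine Lc (Mc B)) (n + 1))) × Fin (3 + 1) => ((b.1, Sum.inl b.2) : Idx (towerTorus Lc (fine Lc (Mc B)) (n + 1)) (Fib 3))) (fun b : ↥(pbox (towerTorus Lc (fine Lc (Mc B)) (n + 1))) × Fin (3 + 1) => ((b.1, Sum.inl b.2) : Idx (towerTorus Lc (fine Lc (Mc B)) (n + 1)) (Fib 3))) - (perF (towerTorus Lc (fine Lc (Mc B)) (n + 1)) (dper (towerTorus Lc (fine Lc (Mc B)) (n + 1)) ((tabsComp (n + 1 + 1)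 (one_le_of_neZero Lc) (Roots.ctr Lc).hr (Pn.cM (n + 1 + 1))).H β.2 (β.1 : Site (3 + 1))))).submatrix (fun b : ↥(pbox (towerTorus Lc (fine Lc (Mc B)) (n + 1))) × Fin (3 + 1) => ((b.1, Sum.inl b.2) : Idx (towerTorus Lc (fine Lc (Mc B)) (n + 1)) (Fib 3))) (fun b : ↥(pbox (towerTorus Lc (fine Lc (Mc B)) (n + 1))) × Fin (3 + 1) => ((b.1, Sum.inl b.2) : Idx (towerTorus Lc (fine Lc (Mc B)) (n + 1)) (Fib 3))) * Matrix.diagonal (fun b : ↥(pbox (towerTorus Lc (fine Lc (Mc B)) (n + 1))) × Fin (3 + 1) => ((lv n) B) (((sn n) * (r n)) • (Pi.single (wrapPt (Mc B) y, μ) (1 : ℝ) : ((↥(pbox (Mc B)) × Fin (3 + 1)) → ℝ))) b.1))) + perF (towerTorus Lc (fine Lc (Mc B)) (n + 1)) (AN (Roots.ctr Lc) (n + 1)) (wrapPt (towerTorus Lc (fine Lc (Mc B)) (n + 1)) (((Lc ^ (n + 1 + 1) : ℕ) : ℤ) • (β.1 : Site (3 + 1))), Sum.inr β.2) (wrapPt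 (towerTorus Lc (fine Lc (Mc B)) (n + 1)) (((Lc ^ (n + 1 + 1) : ℕ) : ℤ) • ((wrapPt (Mc B) y : ↥(pbox (Mc B))) : Site (3 + 1))), Sum.inr μ) • (∑ b : ↥(pbox (towerTorus Lc (fine Lc (Mc B)) (n + 1))) × Fin (3 + 1), (∑ s : ↥(pbox (towerTorus Lc (fine Lc (Mc B)) (n + 1))), tgrad (towerTorus Lc (fine Lc (Mc B)) (n + 1)) (b.1, Sum.inl b.2) s * ((lv n) B) (((sn n) * (r n)) • (Pi.single (wrapPt (Mc B) y', ν) (1 : ℝ) : ((↥(pbox (Mc B)) × Fin (3 + 1)) → ℝ))) s) • ((M₂ n) B) b β - (κ₂ n) • (Matrix.diagonal (fun b : ↥(pbox (towerTorus Lc (fine Lc (Mc B)) (n + 1))) × Fin (3 + 1) => ((lv n) B) (((sn n) * (r n)) • (Pi.single (wrapPt (Mc B) y', ν) (1 : ℝ) : ((↥(pbox (Mc B)) × Fin (3 + 1)) → ℝ))) b.1) * (perF (towerTorus Lc (fine Lc (Mc B)) (n + 1)) (dper (towerTorus Lc (fine Lc (Mc B)) (n + 1)) ((tabsComp (n + 1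 + 1) (one_le_of_neZero Lc) (Roots.ctr Lc).hr (Pn.cM (n + 1 + 1))).H β.2 (β.1 : Site (3 + 1))))).submatrix (fun b : ↥(pbox (towerTorus Lc (fine Lc (Mc B)) (n + 1))) × Fin (3 + 1) => ((b.1, Sum.inl b.2) : Idx (towerTorus Lc (fine Lc (Mc B)) (n + 1)) (Fib 3))) (fun b : ↥(pbox (towerTorus Lc (fine Lc (Mc B)) (n + 1))) × Fin (3 + 1) => ((b.1, Sum.inl b.2) : Idx (towerTorus Lc (fine Lc (Mc B)) (n + 1)) (Fib 3))) - (perF (towerTorus Lc (fine Lc (Mc B)) (n + 1)) (dper (towerTorus Lc (fine Lc (Mc B)) (n + 1)) ((tabsComp (n + 1 + 1) (one_le_of_neZero Lc) (Roots.ctr Lc).hr (Pn.cM (n + 1 + 1))).H β.2 (β.1 : Site (3 + 1))))).submatrix (fun b : ↥(pbox (towerTorus Lc (fine Lc (Mc B)) (n + 1))) × Fin (3 + 1) => ((b.1, Sum.inl b.2) : Idx (towerTorus Lc (fine Lc (Mc B)) (n + 1)) (Fib 3))) (fun b : ↥(pbox (towerTorus Lc (fine Lc (Mc B)) (n + 1)))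 × Fin (3 + 1) => ((b.1, Sum.inl b.2) : Idx (towerTorus Lc (fine Lc (Mc B)) (n + 1)) (Fib 3))) * Matrix.diagonal (fun b : ↥(pbox (towerTorus Lc (fine Lc (Mc B)) (n + 1))) × Fin (3 + 1) => ((lv n) B) (((sn n) * (r n)) • (Pi.single (wrapPt (Mc B) y', ν) (1 : ℝ) : ((↥(pbox (Mc B)) × Fin (3 + 1)) → ℝ))) b.1)))) := by
  intro n μ y ν y' B
  -- the record letters at depth `n`
  have hT : ∀ i, towerTorus Lc (fine Lc (Mc B)) (n + 1) i = Lc ^ (n + 1 + 1) * Mc B i := towerTorus_fine_apply' Lc (Mc B) n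
  obtain ⟨δv, K, hδv, hK, hlam⟩ := exists_lamRec_loc Lc sn n
  obtain ⟨δS, CS, hδS, hCS, hS⟩ := exists_SRec_decay Lc cS n
  obtain ⟨C, δm, hδm, hmix⟩ := (tabsComp (d := 3) (n + 1 + 1) (one_le_of_neZero Lc) (Roots.ctr Lc).hr (Pn.cM (n + 1 + 1))).hmix
  obtain ⟨C_H, hH⟩ := (tabsComp (d := 3) (n + 1 + 1) (one_le_of_neZero Lc) (Roots.ctr Lc).hr (Pn.cM (n + 1 + 1))).hH 1 zero_le_one
  have hV : 0 ≤ K * latticeConst (3 + 1) δv := mul_nonneg hK (latticeConst_nonneg _ hδv.le)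
  have hΛb : ∀ (μ' : Fin (3 + 1)) (q u : Site (3 + 1)), |∑' e : Site (3 + 1), lamRec Lc (sn n) n μ' (translate (Mc B) q e) u| ≤ K * latticeConst (3 + 1) δv :=
    fun μ' q u => abs_tsum_lam_sources_le (Mc B) (towerTorus Lc (fine Lc (Mc B)) (n + 1)) hT hK hδv hlam μ' q u
  have hΛp : ∀ (μ' : Fin (3 + 1)) (q u m : Site (3 + 1)),
      (∑' e : Site (3 + 1), lamRec Lc (sn n) n μ' (translate (Mc B) q e) (translate (towerTorus Lc (fine Lc (Mc B)) (n + 1)) u m))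
        = ∑' e : Site (3 + 1), lamRec Lc (sn n) n μ' (translate (Mc B) q e) u :=
    fun μ' q u m => tsum_lam_sources_translate_period (lamRec Lc (sn n) n) (Mc B) (towerTorus Lc (fine Lc (Mc B)) (n + 1)) hT (lamRec_translate Lc sn n) μ' q u m
  -- the scaled periodised gauge functions of the right side are bounded and periodic too
  have hΛcb : ∀ (μ' : Fin (3 + 1)) (q u : Site (3 + 1)),
      |(fun u' => ((sn n) * (r n)) * ∑' e : Site (3 + 1), lamRec Lc (sn n) n μ' (translate (Mc B) q e) u') u| ≤ |(sn n) * (r n)| * (K * latticeConst (3 + 1) δv) :=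
    fun μ' q u => by rw [abs_mul]; exact mul_le_mul_of_nonneg_left (hΛb μ' q u) (abs_nonneg _)
  have hΛcp : ∀ (μ' : Fin (3 + 1)) (q u m : Site (3 + 1)),
      (fun u' => ((sn n) * (r n)) * ∑' e : Site (3 + 1), lamRec Lc (sn n) n μ' (translate (Mc B) q e) u') (translate (towerTorus Lc (fine Lc (Mc B)) (n + 1)) u m)
        = (fun u' => ((sn n) * (r n)) * ∑' e : Site (3 + 1), lamRec Lc (sn n) n μ' (translate (Mc B) q e) u') u :=
    fun μ' q u m => by simp only [hΛp μ' q u m]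
  -- the weight on the right side: PART 47
  simp_rw [perF_AN_inr_inr_wrapPt_eq_tsum_wΦ (Roots.ctr Lc) (n + 1) (towerTorus Lc (fine Lc (Mc B)) (n + 1)) (Mc B) hT]
  -- entrywise
  ext b₁ b₂
  simp only [Matrix.submatrix_apply, Matrix.smul_apply, Matrix.sum_apply, Matrix.add_apply, Matrix.sub_apply, smul_eq_mul, Matrix.diagonal_mul, Matrix.mul_diagonal,
    hM₂, perF_apply]
  -- the left side: PART 73 over the record letters, then road (S2) entrywise, `SRec`, `M2Z` unfolded
  rw [doorRec_succ_comp, perZ_dper_tsum_sources_doorZ (tabsComp (d := 3) (n + 1 + 1) (one_le_of_neZero Lc) (Roots.ctr Lc).hr (Pn.cM (n + 1 + 1))) (κ₂ n) (κτ n)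
    (lamRec Lc (sn n) n) (SRec Lc (cS n) n) (Mc B) (towerTorus Lc (fine Lc (Mc B)) (n + 1)) hT hK hδv hlam (lamRec_translate Lc sn n) hCS hδS hS
    (SRec_translate Lc cS n) μ y ν y' (b₁.1 : Site (3 + 1)) (b₂.1 : Site (3 + 1)) (Sum.inl b₁.2) (Sum.inl b₂.2)]
  simp_rw [perZ_dper_defKerZ_inl_inl (Lc ^ (n + 1 + 1)) (tabsComp (d := 3) (n + 1 + 1) (one_le_of_neZero Lc) (Roots.ctr Lc).hr (Pn.cM (n + 1 + 1))) (κ₂ n)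
    (towerTorus Lc (fine Lc (Mc B)) (n + 1)) (Mc B) hT hmix hδm hH one_pos hV (hΛb μ y) (hΛp μ y),
    perZ_dper_defKerZ_inl_inl (Lc ^ (n + 1 + 1)) (tabsComp (d := 3) (n + 1 + 1) (one_le_of_neZero Lc) (Roots.ctr Lc).hr (Pn.cM (n + 1 + 1))) (κ₂ n)
    (towerTorus Lc (fine Lc (Mc B)) (n + 1)) (Mc B) hT hmix hδm hH one_pos hV (hΛb ν y') (hΛp ν y')]
  simp_rw [tsum_SRec_sources Lc cS n (towerTorus Lc (fine Lc (Mc B)) (n + 1)) (Mc B) hT,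
    perF_AN_inr_inr_wrapPt_eq_tsum_wΦ (Roots.ctr Lc) (n + 1) (towerTorus Lc (fine Lc (Mc B)) (n + 1)) (Mc B) hT]
  simp only [M2Z]
  -- the right side: `hlv`, the representative re-indexed away, road (S1) on the torus gradient
  simp_rw [hlv, tsum_lamRec_sources_wrapPt Lc sn n (Mc B)]
  simp_rw [sum_tgrad_inl_mul_of_periodic (Λ := fun u' => ((sn n) * (r n)) * ∑' e : Site (3 + 1), lamRec Lc (sn n) n μ (translate (Mc B) y e) u')
      (towerTorus Lc (fine Lc (Mc B)) (n + 1)) (hΛcp μ y),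
    sum_tgrad_inl_mul_of_periodic (Λ := fun u' => ((sn n) * (r n)) * ∑' e : Site (3 + 1), lamRec Lc (sn n) n ν (translate (Mc B) y' e) u')
      (towerTorus Lc (fine Lc (Mc B)) (n + 1)) (hΛcp ν y')]
  simp_rw [sum_scale_bracket]
  -- both sides: `Σ_κ Σ_{ȳ₀}` against `Σ_β`, scalars, the pin
  rw [Fintype.sum_prod_type, Finset.sum_comm, Finset.mul_sum, Finset.mul_sum]
  refine Finset.sum_congr rfl fun κ _ => ?_
  rw [Finset.mul_sum, Finset.mul_sum]
  refine Finset.sum_congr rfl fun rr _ => ?_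
  exact pin_close (hpin n)

end Summit.QuantumFields.BalabanUV.Beta.FP.TowerDoorRecordPeriodised

end
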